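/-
Copyright: statement-level skeleton of a published paper (lit-balaban cell, Phase-2 proof seat p13, gen 6). No proof
claims beyond what the kernel checks below.
-/
import Literature.MathematicalPhysics.QuantumFieldTheory.Balaban1983to89.B14Eq328GaussianIBP
import Literature.MathematicalPhysics.QuantumFieldTheory.Balaban1983to89.B2Eq228Conditioning
import Literature.MathematicalPhysics.QuantumFieldTheory.BalabanImbrieJaffe1984to88.BIJ88DirichletForms305

/-!
# `BalabanImbrieJaffe1984to88.BIJ88IntegrationByParts305` — T. Bałaban, J. Imbrie, A. Jaffe, *Effective action and
cluster properties of the abelian Higgs model*, Commun. Math. Phys. **114** (1988) 257–315 [BalabanImbrieJaffe1988],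
§5.13 p. 305–306 [PDF 49–50]: **"Recall that we have a linear term in the measure, e^{⟨Φ,ℱ⟩}. With this term,
integration by parts replaces Φ by C_s(δ/δΦ) + C_sℱ (see Eqs. (12.2), (12.3) of [3] where a similar expansion is
used). We integrate by parts all fields appearing in this formula. Each Φ contracts through a C_s to another Φ, to an
f(□_i) or to ℱ."** — PROVED for the finite-dimensional Gaussian integral with weight `e^{−½⟨Φ,AΦ⟩}e^{⟨ℱ,Φ⟩}`
(`A = −Δ_s` positive definite, `C_s = A⁻¹`): the replacement rule `Φ(x) ↦ Σ_y C_s(x,y) ∂/∂Φ(y) + (C_sℱ)(x)` under the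
integral, and its one-step form against a monomial in the fields times a bounded `C¹` factor, exhibiting the three
printed contraction types.

statement-level skeleton of published theorems with citation tags; proofs where landed; nothing here is a claim
about the Yang–Mills mass gap

PDF held: `paper:balaban1988-cmp114-bij-abelian-higgs-effective-action` (journal page = PDF page + 256; p. 305–306
read with `lit read … --pages 49-50`; reference list PDF 58–59: [3] = Bałaban–Brydges–Imbrie–Jaffe, *The mass gap for
Higgs models on a unit lattice*; [9] = Glimm–Jaffe–Spencer).

CITATION HEADER (lean-in-tree rule).  lit-balaban cell (HOME `run/shared/lean/pub/lit-balaban/`), Phase 2, seat p13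
gen 6 (unit `lit-balaban-p13-g6`); fourth file of the p. 305–306 group after `…BIJ88CsDecay305` (p254974: `C_s`
exists and decays), `…BIJ88CsClusters306` (p255115: `Δ_s`, `C_s` cluster-block-diagonal), `…BIJ88ClusterFactorization306`
(p255752: the Gaussian integral factorizes over clusters); row **C2.Eq5.13.3-5.13.4** of
`HOME/lit-balaban-r16/ROWS-C2-part2.md` (owner r16, referee ref-5), the p. 305 member quoted above.  The Gaussian
integration-by-parts formula itself is Glimm–Jaffe, *Quantum Physics* §9.1 (9.1.28) `∫ φ(f)A dφ_C = ∫ ⟨Cf, δA/δφ⟩ dφ_C`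
and its tilted form (9.1.32) [GlimmJaffe1987], PROVED in finite dimensions in the tree file
`…Balaban1983to89.B14Eq328GaussianIBP` (lit-balaban r11/p27: `integral_dotProduct_mul_mul_gaussDensity_of_integrable`,
`eq328_tilted_ibp`, `hasFDerivAt_dotProduct_const`, `differentiable_gaussDensity`, `integrable_linear_tilt_gaussDensity`)
— USED BY NAME, nothing restated; the weight `weight A Φ = e^{−½⟨Φ,AΦ⟩}` and the linear term `source ℱ Φ = e^{Σℱ(x)Φ(x)}`
are those of `…Balaban1983to89.B2Eq228Conditioning` (as in `…BIJ88ClusterFactorization306`); the interpolated form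
`Δ_s = interpForm blk Δ s` and its positivity `interpForm_posDef` are p02's `…BIJ88DirichletForms305`.

## The print (verbatim, p. 305–306)

*"Recall that we have a linear term in the measure, e^{⟨Φ,ℱ⟩}. With this term, integration by parts replaces Φ by
C_s(δ/δΦ) + C_sℱ (see Eqs. (12.2), (12.3) of [3] where a similar expansion is used). We integrate by parts all fields
appearing in this formula. Each Φ contracts through a C_s to another Φ, to an f(□_i) or to ℱ. If a closed loop forms,
or if a train of covariances beginning and ending in ℱ forms, then the term disappears with truncation. Thus we have
only trains beginning with a δ/δΦ and ending in either δ/δΦ or ℱ."*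

## What is proved (0 `sorry`, standard axioms, theorems only, no new `def`)

Fields `Φ : S → ℝ` on a finite index type `S`; `Φ(w) := Φ ⬝ᵥ w` a linear functional of the field (`w = e_x` gives
`Φ(x)`); precision `A` positive definite (the printed `−Δ_s`), `C := A⁻¹` (the printed `C_s = (−Δ_s)⁻¹`); weight
`e^{−½⟨Φ,AΦ⟩}e^{⟨ℱ,Φ⟩} = weight A Φ * source ℱ Φ`.
* §0 MOMENTS OF THE TILTED GAUSSIAN (the integrabilities the formula needs): `integrable_tilt` (`e^{⟨Φ,g⟩}e^{−½⟨Φ,AΦ⟩}`),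
  `integrable_dotProduct_mul_of_forall` (closure under multiplication by a field, from `|x| ≤ e^x + e^{−x}`, inlined),
  `integrable_fieldProd_tilt` / `integrable_fieldProd_bdd_tilt` (any monomial `Π_{i∈T}Φ(v_i)`, times a bounded factor).
* §1 **THE REPLACEMENT RULE** `ibp_source_of_integrable` (G differentiable, three products integrable) and `ibp_source`
  (`G ∈ C¹` bounded with bounded derivative):
  `∫ Φ(w) G(Φ) e^{−½⟨Φ,AΦ⟩}e^{⟨ℱ,Φ⟩}dΦ = ⟨Cw, ℱ⟩ ∫ G e^{−½⟨Φ,AΦ⟩}e^{⟨ℱ,Φ⟩}dΦ + ∫ (∂_{Cw}G) e^{−½⟨Φ,AΦ⟩}e^{⟨ℱ,Φ⟩}dΦ`,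
  i.e. `Φ(w) ↦ ⟨Cw, δ/δΦ⟩ + ⟨Cw, ℱ⟩`; coordinate form **`ibp_coord`** — verbatim *"Φ by C_s(δ/δΦ) + C_sℱ"*:
  `∫ Φ(x) G = Σ_y C(x,y) ∫ ∂G/∂Φ(y) + (Cℱ)(x) ∫ G` (same weight throughout).
* §2 **"Each Φ contracts through a C_s to another Φ, to an f(□_i) or to ℱ"** (`ibp_fields`): against a monomial
  `Π_{i∈T}Φ(v_i)` times `H ∈ C¹_b` (the product of the `f(□_i)` and cutoffs),
  `∫ Φ(w)·Π_{i∈T}Φ(v_i)·H = Σ_{i∈T} ⟨Cw, v_i⟩ ∫ Π_{j∈T∖i}Φ(v_j)·H` (to another Φ) `+ ∫ Π_{i∈T}Φ(v_i)·∂_{Cw}H` (to an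
  `f(□_i)`) `+ ⟨Cw, ℱ⟩ ∫ Π_{i∈T}Φ(v_i)·H` (to ℱ) — one step of *"We integrate by parts all fields"*; iterating it on the
  remaining fields is the walk bookkeeping of (5.13.3), not spelled out.
* §3 THE PRINTED INSTANCE `A := Δ_s = interpForm blk Δ s` (feed `Δ := −Δ_print`, positive definite; `s ∈ [0,1]^I`):
  `ibp_coord_interp`.
HONEST SCOPE.  Finite-dimensional real Gaussian integrals (Lebesgue measure on `S → ℝ`); the characteristic functions
of the printed measure are formal under `δ/δΦ` in print and are covered here only as `C¹_b` factors (smooth cutoffs);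
truncation (*"the term disappears with truncation"*), the sum over pairings/walks and (5.13.3)–(5.13.4) are NOT
modelled.  NOT summit progress; NOT continuum; NOT Clay.  Imports as listed; modifies nothing.
-/

namespace Literature.MathematicalPhysics.QuantumFieldTheory.BalabanImbrieJaffe1984to88.BIJ88IntegrationByParts305

open MeasureTheory Matrix Finset Filter
open scoped BigOperators
open Literature.MathematicalPhysics.QuantumFieldTheory.Balaban1983to89
open B2Eq228Conditioning (weight source)
open B14.Eq328GaussianIBP
open BIJ88DirichletForms305 (interpForm interpForm_posDef)

variable {S : Type} [Fintype S]

/-! ## §0  Conventions; moments of the linearly tilted Gaussian -/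

/-- The linear term of the measure: `source ℱ Φ = e^{⟨Φ,ℱ⟩}` (*"Recall that we have a linear term in the measure,
e^{⟨Φ,ℱ⟩}"*). [cite: BalabanImbrieJaffe1988, §5.13 p.305] -/
theorem source_eq (f φ : S → ℝ) : source f φ = Real.exp (φ ⬝ᵥ f) := by
  simp only [B2Eq228Conditioning.source, dotProduct]
  exact congrArg Real.exp (Finset.sum_congr rfl fun s _ => mul_comm _ _)

/-- The weight with linear term in the normal form `e^{⟨Φ,ℱ⟩}·e^{−½⟨Φ,AΦ⟩}` of `B14.Eq328GaussianIBP`.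
[cite: BalabanImbrieJaffe1988, §5.13 p.305] -/
theorem weight_mul_source (A : Matrix S S ℝ) (f φ : S → ℝ) :
    weight A φ * source f φ = Real.exp (φ ⬝ᵥ f) * Real.exp (-(1/2 : ℝ) * (φ ⬝ᵥ A *ᵥ φ)) := by
  rw [source_eq, B2Eq228Conditioning.weight]
  exact mul_comm _ _

/-- `e^{−(−1·a)} = e^{a}`: the tilt `e^{−t⟨Φ,w₀⟩}` of `B14.Eq328GaussianIBP` at `t = −1`, `w₀ = ℱ` is the linear term
`e^{⟨Φ,ℱ⟩}`. [cite: BalabanImbrieJaffe1988, §5.13 p.305] -/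
theorem exp_neg_neg_one_mul (a : ℝ) : Real.exp (-((-1 : ℝ) * a)) = Real.exp a := by
  congr 1
  ring

/-- A field `Φ ↦ Φ(w) = Φ ⬝ᵥ w` is continuous. [folklore] [cite: GlimmJaffe1987, §9.1 (9.1.28)] -/
theorem continuous_dotProduct_right (w : S → ℝ) : Continuous fun φ : S → ℝ => φ ⬝ᵥ w :=
  continuous_id.dotProduct continuous_const

/-- The Gaussian weight `Φ ↦ e^{−½⟨Φ,AΦ⟩}` is continuous. [folklore] [cite: GlimmJaffe1987, §9.1 (9.1.28)] -/
theorem continuous_gauss (A : Matrix S S ℝ) :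
    Continuous fun φ : S → ℝ => Real.exp (-(1/2 : ℝ) * (φ ⬝ᵥ A *ᵥ φ)) :=
  (differentiable_gaussDensity A).continuous

variable [DecidableEq S]

omit [Fintype S] [DecidableEq S] in
/-- A positive definite real matrix is symmetric. [folklore] [cite: GlimmJaffe1987, §9.1 (9.1.28)] -/
theorem isSymm_of_posDef {A : Matrix S S ℝ} (hA : A.PosDef) : A.IsSymm := by
  have h := hA.isHermitian
  rw [Matrix.IsHermitian, Matrix.conjTranspose_eq_transpose_of_trivial] at h
  exact h

/-- The linearly tilted Gaussian `Φ ↦ e^{⟨Φ,g⟩}e^{−½⟨Φ,AΦ⟩}` (`A` positive definite) is integrable — a translate of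
the Gaussian (Glimm–Jaffe (9.1.27)). [cite: GlimmJaffe1987, §9.1 (9.1.27)] [cite: BalabanImbrieJaffe1988, §5.13 p.305] -/
theorem integrable_tilt {A : Matrix S S ℝ} (hA : A.PosDef) (g : S → ℝ) :
    Integrable fun φ : S → ℝ => Real.exp (φ ⬝ᵥ g) * Real.exp (-(1/2 : ℝ) * (φ ⬝ᵥ A *ᵥ φ)) := by
  have hAu : IsUnit A.det := isUnit_iff_ne_zero.2 hA.det_pos.ne'
  have h := integrable_linear_tilt_gaussDensity A⁻¹ hA.inv g (-1)
  rw [Matrix.nonsing_inv_nonsing_inv A hAu] at h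
  exact h.congr (Eventually.of_forall fun φ => by dsimp only; rw [exp_neg_neg_one_mul])

/-- A bounded measurable factor times the tilted Gaussian weight `e^{−½⟨Φ,AΦ⟩}e^{⟨ℱ,Φ⟩}` is integrable.
[cite: GlimmJaffe1987, §9.1 (9.1.27)] [cite: BalabanImbrieJaffe1988, §5.13 p.305] -/
theorem integrable_bdd_mul_weight_source {A : Matrix S S ℝ} (hA : A.PosDef) (f : S → ℝ) {F : (S → ℝ) → ℝ}
    (hFm : AEStronglyMeasurable F volume) {K : ℝ} (hK : ∀ φ, ‖F φ‖ ≤ K) :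
    Integrable fun φ : S → ℝ => F φ * (weight A φ * source f φ) :=
  ((integrable_tilt hA f).bdd_mul hFm (Eventually.of_forall hK)).congr
    (Eventually.of_forall fun φ => by dsimp only; rw [weight_mul_source])

omit [DecidableEq S] in
/-- **Moments, closure step**: if `F·e^{⟨Φ,g⟩}e^{−½⟨Φ,AΦ⟩}` is integrable for EVERY linear tilt `g`, then so is
`Φ(w)·F·e^{⟨Φ,g⟩}e^{−½⟨Φ,AΦ⟩}` (bound `|Φ(w)| ≤ e^{Φ(w)} + e^{−Φ(w)}` and absorb the exponentials into the tilt).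
[folklore] [cite: GlimmJaffe1987, §9.1 (9.1.28)] -/
theorem integrable_dotProduct_mul_of_forall (A : Matrix S S ℝ) {F : (S → ℝ) → ℝ} (hF : Continuous F)
    (hI : ∀ g : S → ℝ, Integrable fun φ : S → ℝ =>
      F φ * (Real.exp (φ ⬝ᵥ g) * Real.exp (-(1/2 : ℝ) * (φ ⬝ᵥ A *ᵥ φ))))
    (w g : S → ℝ) :
    Integrable fun φ : S → ℝ =>
      (φ ⬝ᵥ w) * F φ * (Real.exp (φ ⬝ᵥ g) * Real.exp (-(1/2 : ℝ) * (φ ⬝ᵥ A *ᵥ φ))) := by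
  refine ((hI (g + w)).norm.add (hI (g + -w)).norm).mono' ?_ (Eventually.of_forall fun φ => ?_)
  · exact (((continuous_dotProduct_right w).mul hF).mul
      (((continuous_dotProduct_right g).rexp).mul (continuous_gauss A))).aestronglyMeasurable
  · -- `|x| ≤ e^x + e^{−x}`: polynomial moments are dominated by exponential ones
    have hb : |φ ⬝ᵥ w| ≤ Real.exp (φ ⬝ᵥ w) + Real.exp (-(φ ⬝ᵥ w)) := by
      rcases le_total 0 (φ ⬝ᵥ w) with hx | hx
      · rw [abs_of_nonneg hx]
        linarith [Real.add_one_le_exp (φ ⬝ᵥ w), Real.exp_pos (-(φ ⬝ᵥ w))]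
      · rw [abs_of_nonpos hx]
        linarith [Real.add_one_le_exp (-(φ ⬝ᵥ w)), Real.exp_pos (φ ⬝ᵥ w)]
    simp only [Pi.add_apply, Real.norm_eq_abs, abs_mul, Real.abs_exp, dotProduct_add, dotProduct_neg,
      Real.exp_add]
    have key := mul_le_mul_of_nonneg_right hb
      (show (0 : ℝ) ≤ |F φ| * (Real.exp (φ ⬝ᵥ g) * Real.exp (-(1/2 : ℝ) * (φ ⬝ᵥ A *ᵥ φ))) by positivity)
    nlinarith [key]

/-- **Moments of the tilted Gaussian**: every monomial in the fields, `Π_{i∈T} Φ(v_i)`, is integrable against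
`e^{⟨Φ,g⟩}e^{−½⟨Φ,AΦ⟩}` (`A` positive definite) — the integrability behind *"We integrate by parts all fields appearing
in this formula"*. [folklore] [cite: GlimmJaffe1987, §9.1 (9.1.28)] [cite: BalabanImbrieJaffe1988, §5.13 p.305] -/
theorem integrable_fieldProd_tilt {A : Matrix S S ℝ} (hA : A.PosDef) {κ : Type*} (T : Finset κ) (v : κ → S → ℝ)
    (g : S → ℝ) :
    Integrable fun φ : S → ℝ =>
      (∏ i ∈ T, φ ⬝ᵥ v i) * (Real.exp (φ ⬝ᵥ g) * Real.exp (-(1/2 : ℝ) * (φ ⬝ᵥ A *ᵥ φ))) := by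
  classical
  induction T using Finset.induction_on generalizing g with
  | empty => simpa only [Finset.prod_empty, one_mul] using integrable_tilt hA g
  | insert a T ha ih =>
    have hc : Continuous fun φ : S → ℝ => ∏ i ∈ T, φ ⬝ᵥ v i :=
      continuous_finsetProd T fun i _ => continuous_dotProduct_right (v i)
    refine (integrable_dotProduct_mul_of_forall A hc ih (v a) g).congr (Eventually.of_forall fun φ => ?_)
    dsimp only
    rw [Finset.prod_insert ha]

/-- Monomial in the fields times a bounded measurable factor (the `f(□_i)`, the cutoffs) against the tilted Gaussian
is integrable. [folklore] [cite: GlimmJaffe1987, §9.1 (9.1.28)] [cite: BalabanImbrieJaffe1988, §5.13 p.305] -/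
theorem integrable_fieldProd_bdd_tilt {A : Matrix S S ℝ} (hA : A.PosDef) {κ : Type*} (T : Finset κ)
    (v : κ → S → ℝ) (g : S → ℝ) {H : (S → ℝ) → ℝ} (hHm : AEStronglyMeasurable H volume) {K : ℝ}
    (hK : ∀ φ, ‖H φ‖ ≤ K) :
    Integrable fun φ : S → ℝ =>
      (∏ i ∈ T, φ ⬝ᵥ v i) * H φ * (Real.exp (φ ⬝ᵥ g) * Real.exp (-(1/2 : ℝ) * (φ ⬝ᵥ A *ᵥ φ))) := by
  refine ((integrable_fieldProd_tilt hA T v g).bdd_mul hHm (Eventually.of_forall hK)).congr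
    (Eventually.of_forall fun φ => ?_)
  dsimp only
  ring

omit [DecidableEq S] in
/-- Derivative of the linear term: `D(e^{⟨·,ℱ⟩})(Φ)u = e^{⟨Φ,ℱ⟩}⟨u,ℱ⟩` — the source of the `C_sℱ` part of the
replacement rule. [cite: BalabanImbrieJaffe1988, §5.13 p.305] [cite: GlimmJaffe1987, §9.1 (9.1.32)] -/
theorem hasFDerivAt_expDot (f x : S → ℝ) :
    ∃ D : (S → ℝ) →L[ℝ] ℝ, HasFDerivAt (fun v : S → ℝ => Real.exp (v ⬝ᵥ f)) D x ∧
      ∀ u, D u = Real.exp (x ⬝ᵥ f) * (u ⬝ᵥ f) := by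
  obtain ⟨L, hL, hLu⟩ := hasFDerivAt_dotProduct_const f x
  have hE : HasFDerivAt (fun v : S → ℝ => Real.exp (v ⬝ᵥ f)) (Real.exp (x ⬝ᵥ f) • L) x :=
    (Real.hasDerivAt_exp _).comp_hasFDerivAt x hL
  exact ⟨_, hE, fun u => by rw [_root_.smul_apply, hLu, smul_eq_mul]⟩

/-! ## §1  The replacement rule `Φ ↦ C_s(δ/δΦ) + C_sℱ` -/

/-- **"integration by parts replaces Φ by C_s(δ/δΦ) + C_sℱ"** — general observables.  For `A` positive definite
(`A = −Δ_s`, `C_s = A⁻¹`), `G` differentiable, and the three products integrable against `e^{−½⟨Φ,AΦ⟩}e^{⟨ℱ,Φ⟩}`: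
`∫ Φ(w) G = ⟨C_s w, ℱ⟩ ∫ G + ∫ ∂_{C_s w} G` (all integrals against the same weight).  Proof: Glimm–Jaffe (9.1.28)
(`B14.Eq328GaussianIBP.integral_dotProduct_mul_mul_gaussDensity_of_integrable`) applied to `e^{⟨ℱ,·⟩}G`.
[cite: BalabanImbrieJaffe1988, §5.13 p.305] [cite: GlimmJaffe1987, §9.1 (9.1.28), (9.1.32)] -/
theorem ibp_source_of_integrable (A : Matrix S S ℝ) (hA : A.PosDef) (f : S → ℝ) {G : (S → ℝ) → ℝ}
    (hG : ∀ φ, DifferentiableAt ℝ G φ) (w : S → ℝ)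
    (i1 : Integrable fun φ : S → ℝ => (φ ⬝ᵥ w) * G φ * (weight A φ * source f φ))
    (i2 : Integrable fun φ : S → ℝ => fderiv ℝ G φ (A⁻¹ *ᵥ w) * (weight A φ * source f φ))
    (i3 : Integrable fun φ : S → ℝ => G φ * (weight A φ * source f φ)) :
    ∫ φ : S → ℝ, (φ ⬝ᵥ w) * G φ * (weight A φ * source f φ)
      = ((A⁻¹ *ᵥ w) ⬝ᵥ f) * (∫ φ : S → ℝ, G φ * (weight A φ * source f φ))
        + ∫ φ : S → ℝ, fderiv ℝ G φ (A⁻¹ *ᵥ w) * (weight A φ * source f φ) := by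
  -- the tilted observable `G' = e^{⟨ℱ,·⟩} G` and its derivative along `C_s w`
  have hGD : ∀ φ : S → ℝ, ∃ D : (S → ℝ) →L[ℝ] ℝ,
      HasFDerivAt (fun v : S → ℝ => Real.exp (v ⬝ᵥ f) * G v) D φ ∧
      ∀ u, D u = Real.exp (φ ⬝ᵥ f) * (u ⬝ᵥ f) * G φ + Real.exp (φ ⬝ᵥ f) * fderiv ℝ G φ u := fun φ => by
    obtain ⟨E, hE, hEu⟩ := hasFDerivAt_expDot f φ
    refine ⟨_, hE.mul (hG φ).hasFDerivAt, fun u => ?_⟩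
    simp only [_root_.add_apply, _root_.smul_apply, hEu, smul_eq_mul]
    ring
  have hG'd : ∀ φ : S → ℝ, DifferentiableAt ℝ (fun v : S → ℝ => Real.exp (v ⬝ᵥ f) * G v) φ := fun φ => by
    obtain ⟨D, hD, -⟩ := hGD φ
    exact hD.differentiableAt
  have hG' : ∀ φ : S → ℝ, fderiv ℝ (fun v : S → ℝ => Real.exp (v ⬝ᵥ f) * G v) φ (A⁻¹ *ᵥ w)
      = ((A⁻¹ *ᵥ w) ⬝ᵥ f) * (Real.exp (φ ⬝ᵥ f) * G φ) + Real.exp (φ ⬝ᵥ f) * fderiv ℝ G φ (A⁻¹ *ᵥ w) :=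
    fun φ => by
    obtain ⟨D, hD, hDu⟩ := hGD φ
    rw [hD.fderiv, hDu]
    ring
  -- the three integrabilities in the normal form of `B14.Eq328GaussianIBP`
  have e : ∀ φ : S → ℝ, weight A φ * source f φ
      = Real.exp (φ ⬝ᵥ f) * Real.exp (-(1/2 : ℝ) * (φ ⬝ᵥ A *ᵥ φ)) := weight_mul_source A f
  have j1 : Integrable fun φ : S → ℝ =>
      (φ ⬝ᵥ w) * (Real.exp (φ ⬝ᵥ f) * G φ) * Real.exp (-(1/2 : ℝ) * (φ ⬝ᵥ A *ᵥ φ)) :=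
    i1.congr (Eventually.of_forall fun φ => by dsimp only; rw [e]; ring)
  have j3 : Integrable fun φ : S → ℝ =>
      (Real.exp (φ ⬝ᵥ f) * G φ) * Real.exp (-(1/2 : ℝ) * (φ ⬝ᵥ A *ᵥ φ)) :=
    i3.congr (Eventually.of_forall fun φ => by dsimp only; rw [e]; ring)
  have j2a : Integrable fun φ : S → ℝ => ((A⁻¹ *ᵥ w) ⬝ᵥ f) * (G φ * (weight A φ * source f φ)) :=
    i3.const_mul _
  have j2 : Integrable fun φ : S → ℝ =>
      fderiv ℝ (fun v : S → ℝ => Real.exp (v ⬝ᵥ f) * G v) φ (A⁻¹ *ᵥ w) *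
        Real.exp (-(1/2 : ℝ) * (φ ⬝ᵥ A *ᵥ φ)) := by
    refine (j2a.add i2).congr (Eventually.of_forall fun φ => ?_)
    simp only [Pi.add_apply, hG' φ, e]
    ring
  have hibp := integral_dotProduct_mul_mul_gaussDensity_of_integrable A hA hG'd w j1 j2 j3
  calc ∫ φ : S → ℝ, (φ ⬝ᵥ w) * G φ * (weight A φ * source f φ)
      = ∫ φ : S → ℝ, (φ ⬝ᵥ w) * (Real.exp (φ ⬝ᵥ f) * G φ) * Real.exp (-(1/2 : ℝ) * (φ ⬝ᵥ A *ᵥ φ)) := by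
        congr 1
        funext φ
        rw [e]
        ring
    _ = ∫ φ : S → ℝ, fderiv ℝ (fun v : S → ℝ => Real.exp (v ⬝ᵥ f) * G v) φ (A⁻¹ *ᵥ w) *
          Real.exp (-(1/2 : ℝ) * (φ ⬝ᵥ A *ᵥ φ)) := hibp
    _ = ∫ φ : S → ℝ, (((A⁻¹ *ᵥ w) ⬝ᵥ f) * (G φ * (weight A φ * source f φ))
          + fderiv ℝ G φ (A⁻¹ *ᵥ w) * (weight A φ * source f φ)) := by
        congr 1
        funext φ
        rw [hG' φ, e]
        ring
    _ = ((A⁻¹ *ᵥ w) ⬝ᵥ f) * (∫ φ : S → ℝ, G φ * (weight A φ * source f φ))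
          + ∫ φ : S → ℝ, fderiv ℝ G φ (A⁻¹ *ᵥ w) * (weight A φ * source f φ) := by
        rw [integral_add j2a i2, integral_const_mul]

/-- **"integration by parts replaces Φ by C_s(δ/δΦ) + C_sℱ"** — bounded `C¹` observables (`G ∈ C¹`, `G` and `DG`
bounded — e.g. the product of the `f(□_i)` and smooth cutoffs; the three integrabilities are discharged by §0):
`∫ Φ(w) G = ⟨C_s w, ℱ⟩ ∫ G + ∫ ∂_{C_s w} G` against `e^{−½⟨Φ,AΦ⟩}e^{⟨ℱ,Φ⟩}` (Glimm–Jaffe (9.1.32) with the linear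
tilt `e^{⟨ℱ,Φ⟩}`; cf. `B14.Eq328GaussianIBP.eq328_tilted_ibp` at `t = −1`, `w₀ = ℱ`).
[cite: BalabanImbrieJaffe1988, §5.13 p.305] [cite: GlimmJaffe1987, §9.1 (9.1.32)] -/
theorem ibp_source (A : Matrix S S ℝ) (hA : A.PosDef) (f : S → ℝ) {G : (S → ℝ) → ℝ} (hG : ContDiff ℝ 1 G)
    {K₀ K₁ : ℝ} (h0 : ∀ φ, ‖G φ‖ ≤ K₀) (h1 : ∀ φ, ‖fderiv ℝ G φ‖ ≤ K₁) (w : S → ℝ) :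
    ∫ φ : S → ℝ, (φ ⬝ᵥ w) * G φ * (weight A φ * source f φ)
      = ((A⁻¹ *ᵥ w) ⬝ᵥ f) * (∫ φ : S → ℝ, G φ * (weight A φ * source f φ))
        + ∫ φ : S → ℝ, fderiv ℝ G φ (A⁻¹ *ᵥ w) * (weight A φ * source f φ) := by
  have hGc : Continuous G := hG.continuous
  have hG'c : Continuous fun φ : S → ℝ => fderiv ℝ G φ (A⁻¹ *ᵥ w) :=
    (hG.continuous_fderiv one_ne_zero).clm_apply continuous_const
  have hG'b : ∀ φ : S → ℝ, ‖fderiv ℝ G φ (A⁻¹ *ᵥ w)‖ ≤ K₁ * ‖A⁻¹ *ᵥ w‖ := fun φ =>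
    ((fderiv ℝ G φ).le_opNorm _).trans (mul_le_mul_of_nonneg_right (h1 φ) (norm_nonneg _))
  have hall : ∀ g : S → ℝ, Integrable fun φ : S → ℝ =>
      G φ * (Real.exp (φ ⬝ᵥ g) * Real.exp (-(1/2 : ℝ) * (φ ⬝ᵥ A *ᵥ φ))) := fun g =>
    (integrable_tilt hA g).bdd_mul hGc.aestronglyMeasurable (Eventually.of_forall h0)
  exact ibp_source_of_integrable A hA f (fun φ => hG.differentiable one_ne_zero φ) w
    ((integrable_dotProduct_mul_of_forall A hGc hall w f).congr
      (Eventually.of_forall fun φ => by dsimp only; rw [weight_mul_source]))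
    (integrable_bdd_mul_weight_source hA f hG'c.aestronglyMeasurable hG'b)
    (integrable_bdd_mul_weight_source hA f hGc.aestronglyMeasurable h0)

/-- A continuous linear functional on field space is determined by its values on the coordinate fields:
`L u = Σ_y u(y) L(e_y)` — turns `∂_{C_s w}` into `Σ_y (C_s w)(y) ∂/∂Φ(y)`. [folklore]
[cite: BalabanImbrieJaffe1988, §5.13 p.305] -/
theorem clm_apply_eq_sum (L : (S → ℝ) →L[ℝ] ℝ) (u : S → ℝ) :
    L u = ∑ y, u y * L (Pi.single y 1) := by
  conv_lhs => rw [pi_eq_sum_univ' u]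
  rw [map_sum]
  exact Finset.sum_congr rfl fun y _ => by rw [map_smul, smul_eq_mul]

/-- **THE PRINTED REPLACEMENT RULE, coordinate form** — *"integration by parts replaces Φ by C_s(δ/δΦ) + C_sℱ"*:
for `A` positive definite (`C_s = A⁻¹`) and `G ∈ C¹_b`,
`∫ Φ(x) G(Φ) e^{−½⟨Φ,AΦ⟩}e^{⟨ℱ,Φ⟩}dΦ = Σ_y C_s(x,y) ∫ (∂G/∂Φ(y)) e^{−½⟨Φ,AΦ⟩}e^{⟨ℱ,Φ⟩}dΦ + (C_sℱ)(x) ∫ G e^{−½⟨Φ,AΦ⟩}e^{⟨ℱ,Φ⟩}dΦ`.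
[cite: BalabanImbrieJaffe1988, §5.13 p.305] [cite: GlimmJaffe1987, §9.1 (9.1.28), (9.1.32)] -/
theorem ibp_coord (A : Matrix S S ℝ) (hA : A.PosDef) (f : S → ℝ) {G : (S → ℝ) → ℝ} (hG : ContDiff ℝ 1 G)
    {K₀ K₁ : ℝ} (h0 : ∀ φ, ‖G φ‖ ≤ K₀) (h1 : ∀ φ, ‖fderiv ℝ G φ‖ ≤ K₁) (x : S) :
    ∫ φ : S → ℝ, φ x * G φ * (weight A φ * source f φ)
      = (∑ y, A⁻¹ x y * ∫ φ : S → ℝ, fderiv ℝ G φ (Pi.single y 1) * (weight A φ * source f φ))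
        + (A⁻¹ *ᵥ f) x * ∫ φ : S → ℝ, G φ * (weight A φ * source f φ) := by
  have hs : A⁻¹.IsSymm := (isSymm_of_posDef hA).inv
  have h := ibp_source A hA f hG h0 h1 (Pi.single x 1)
  have hcol : A⁻¹ *ᵥ Pi.single x 1 = fun y => A⁻¹ x y := by
    rw [Matrix.mulVec_single_one]
    funext y
    rw [Matrix.col_apply, hs.apply]
  have hlhs : ∫ φ : S → ℝ, φ x * G φ * (weight A φ * source f φ)
      = ∫ φ : S → ℝ, (φ ⬝ᵥ Pi.single x 1) * G φ * (weight A φ * source f φ) := by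
    simp only [dotProduct_single_one]
  -- `∂_{C_s e_x} G = Σ_y C_s(x,y) ∂G/∂Φ(y)` under the integral
  have hGc : ∀ y : S, Continuous fun φ : S → ℝ => fderiv ℝ G φ (Pi.single y 1) := fun y =>
    (hG.continuous_fderiv one_ne_zero).clm_apply continuous_const
  have hGb : ∀ (y : S) (φ : S → ℝ), ‖fderiv ℝ G φ (Pi.single y 1)‖ ≤ K₁ * ‖(Pi.single y 1 : S → ℝ)‖ :=
    fun y φ => ((fderiv ℝ G φ).le_opNorm _).trans (mul_le_mul_of_nonneg_right (h1 φ) (norm_nonneg _))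
  have hI : ∀ y ∈ (Finset.univ : Finset S), Integrable fun φ : S → ℝ =>
      A⁻¹ x y * (fderiv ℝ G φ (Pi.single y 1) * (weight A φ * source f φ)) := fun y _ =>
    (integrable_bdd_mul_weight_source hA f (hGc y).aestronglyMeasurable (hGb y)).const_mul _
  have hint : ∫ φ : S → ℝ, fderiv ℝ G φ (fun y => A⁻¹ x y) * (weight A φ * source f φ)
      = ∑ y, A⁻¹ x y * ∫ φ : S → ℝ, fderiv ℝ G φ (Pi.single y 1) * (weight A φ * source f φ) := by
    calc ∫ φ : S → ℝ, fderiv ℝ G φ (fun y => A⁻¹ x y) * (weight A φ * source f φ)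
        = ∫ φ : S → ℝ, ∑ y, A⁻¹ x y * (fderiv ℝ G φ (Pi.single y 1) * (weight A φ * source f φ)) := by
          congr 1
          funext φ
          rw [clm_apply_eq_sum (fderiv ℝ G φ), Finset.sum_mul]
          exact Finset.sum_congr rfl fun y _ => by ring
      _ = ∑ y, ∫ φ : S → ℝ, A⁻¹ x y * (fderiv ℝ G φ (Pi.single y 1) * (weight A φ * source f φ)) :=
          integral_finsetSum _ hI
      _ = ∑ y, A⁻¹ x y * ∫ φ : S → ℝ, fderiv ℝ G φ (Pi.single y 1) * (weight A φ * source f φ) :=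
          Finset.sum_congr rfl fun y _ => integral_const_mul _ _
  have hCF : (fun y => A⁻¹ x y) ⬝ᵥ f = (A⁻¹ *ᵥ f) x := rfl
  rw [hlhs, h, hcol, hint, hCF, add_comm]

/-! ## §2  "Each Φ contracts through a C_s to another Φ, to an f(□_i) or to ℱ" -/

/-- **ONE FIELD AGAINST A MONOMIAL TIMES A BOUNDED FACTOR** — *"We integrate by parts all fields appearing in this
formula. Each Φ contracts through a C_s to another Φ, to an f(□_i) or to ℱ"*: for `A` positive definite (`C_s = A⁻¹`),
a monomial `Π_{i∈T}Φ(v_i)` in the fields and `H ∈ C¹_b` (the `f(□_i)` and cutoffs),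
`∫ Φ(w)·Π_{i∈T}Φ(v_i)·H = Σ_{i∈T} ⟨C_s w, v_i⟩ ∫ Π_{j∈T∖{i}}Φ(v_j)·H` (Φ contracts through a `C_s` to another Φ)
`+ ∫ Π_{i∈T}Φ(v_i)·∂_{C_s w}H` (to an `f(□_i)`) `+ ⟨C_s w, ℱ⟩ ∫ Π_{i∈T}Φ(v_i)·H` (to ℱ), all integrals against
`e^{−½⟨Φ,AΦ⟩}e^{⟨ℱ,Φ⟩}`. [cite: BalabanImbrieJaffe1988, §5.13 p.305–306] [cite: GlimmJaffe1987, §9.1 (9.1.28)] -/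
theorem ibp_fields (A : Matrix S S ℝ) (hA : A.PosDef) (f : S → ℝ) {κ : Type*} [DecidableEq κ] (T : Finset κ)
    (v : κ → S → ℝ) {H : (S → ℝ) → ℝ} (hH : ContDiff ℝ 1 H) {K₀ K₁ : ℝ} (h0 : ∀ φ, ‖H φ‖ ≤ K₀)
    (h1 : ∀ φ, ‖fderiv ℝ H φ‖ ≤ K₁) (w : S → ℝ) :
    ∫ φ : S → ℝ, (φ ⬝ᵥ w) * ((∏ i ∈ T, φ ⬝ᵥ v i) * H φ) * (weight A φ * source f φ)
      = (∑ i ∈ T, ((A⁻¹ *ᵥ w) ⬝ᵥ v i) *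
            ∫ φ : S → ℝ, (∏ j ∈ T.erase i, φ ⬝ᵥ v j) * H φ * (weight A φ * source f φ))
        + (∫ φ : S → ℝ, (∏ i ∈ T, φ ⬝ᵥ v i) * fderiv ℝ H φ (A⁻¹ *ᵥ w) * (weight A φ * source f φ))
        + ((A⁻¹ *ᵥ w) ⬝ᵥ f) * ∫ φ : S → ℝ, (∏ i ∈ T, φ ⬝ᵥ v i) * H φ * (weight A φ * source f φ) := by
  have hHd : Differentiable ℝ H := hH.differentiable one_ne_zero
  have hHc : Continuous H := hH.continuous
  have hH'c : Continuous fun φ : S → ℝ => fderiv ℝ H φ (A⁻¹ *ᵥ w) :=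
    (hH.continuous_fderiv one_ne_zero).clm_apply continuous_const
  have hH'b : ∀ φ : S → ℝ, ‖fderiv ℝ H φ (A⁻¹ *ᵥ w)‖ ≤ K₁ * ‖A⁻¹ *ᵥ w‖ := fun φ =>
    ((fderiv ℝ H φ).le_opNorm _).trans (mul_le_mul_of_nonneg_right (h1 φ) (norm_nonneg _))
  -- derivative of the monomial `P = Π_{i∈T} Φ(v_i)` and of `G = P·H`
  have hP : ∀ φ : S → ℝ, ∃ D : (S → ℝ) →L[ℝ] ℝ,
      HasFDerivAt (fun ψ : S → ℝ => ∏ i ∈ T, ψ ⬝ᵥ v i) D φ ∧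
      ∀ z, D z = ∑ i ∈ T, (∏ j ∈ T.erase i, φ ⬝ᵥ v j) * (z ⬝ᵥ v i) := fun φ => by
    choose L hL hLz using fun i => hasFDerivAt_dotProduct_const (v i) φ
    refine ⟨_, HasFDerivAt.finsetProd (u := T) (fun i _ => hL i), fun z => ?_⟩
    simp only [_root_.sum_apply, _root_.smul_apply, smul_eq_mul, hLz]
  have hGD : ∀ φ : S → ℝ, ∃ D : (S → ℝ) →L[ℝ] ℝ,
      HasFDerivAt (fun ψ : S → ℝ => (∏ i ∈ T, ψ ⬝ᵥ v i) * H ψ) D φ ∧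
      ∀ z, D z = (∏ i ∈ T, φ ⬝ᵥ v i) * fderiv ℝ H φ z
        + H φ * ∑ i ∈ T, (∏ j ∈ T.erase i, φ ⬝ᵥ v j) * (z ⬝ᵥ v i) := fun φ => by
    obtain ⟨D, hD, hDz⟩ := hP φ
    refine ⟨_, hD.mul (hHd φ).hasFDerivAt, fun z => ?_⟩
    simp only [_root_.add_apply, _root_.smul_apply, hDz, smul_eq_mul]
  have hGd : ∀ φ : S → ℝ, DifferentiableAt ℝ (fun ψ : S → ℝ => (∏ i ∈ T, ψ ⬝ᵥ v i) * H ψ) φ := fun φ => by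
    obtain ⟨D, hD, -⟩ := hGD φ
    exact hD.differentiableAt
  have hG' : ∀ φ : S → ℝ, fderiv ℝ (fun ψ : S → ℝ => (∏ i ∈ T, ψ ⬝ᵥ v i) * H ψ) φ (A⁻¹ *ᵥ w)
      = (∏ i ∈ T, φ ⬝ᵥ v i) * fderiv ℝ H φ (A⁻¹ *ᵥ w)
        + H φ * ∑ i ∈ T, (∏ j ∈ T.erase i, φ ⬝ᵥ v j) * ((A⁻¹ *ᵥ w) ⬝ᵥ v i) := fun φ => by
    obtain ⟨D, hD, hDz⟩ := hGD φ
    rw [hD.fderiv, hDz]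
  -- integrabilities (moments of the tilted Gaussian, §0)
  have e : ∀ φ : S → ℝ, weight A φ * source f φ
      = Real.exp (φ ⬝ᵥ f) * Real.exp (-(1/2 : ℝ) * (φ ⬝ᵥ A *ᵥ φ)) := weight_mul_source A f
  have iPH : ∀ T' : Finset κ, Integrable fun φ : S → ℝ =>
      (∏ i ∈ T', φ ⬝ᵥ v i) * H φ * (weight A φ * source f φ) := fun T' =>
    (integrable_fieldProd_bdd_tilt hA T' v f hHc.aestronglyMeasurable h0).congr
      (Eventually.of_forall fun φ => by dsimp only; rw [e])
  have iPH' : Integrable fun φ : S → ℝ =>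
      (∏ i ∈ T, φ ⬝ᵥ v i) * fderiv ℝ H φ (A⁻¹ *ᵥ w) * (weight A φ * source f φ) :=
    (integrable_fieldProd_bdd_tilt hA T v f hH'c.aestronglyMeasurable hH'b).congr
      (Eventually.of_forall fun φ => by dsimp only; rw [e])
  have i1 : Integrable fun φ : S → ℝ =>
      (φ ⬝ᵥ w) * ((∏ i ∈ T, φ ⬝ᵥ v i) * H φ) * (weight A φ * source f φ) := by
    have hc : Continuous fun φ : S → ℝ => (∏ i ∈ T, φ ⬝ᵥ v i) * H φ :=
      (continuous_finsetProd T fun i _ => continuous_dotProduct_right (v i)).mul hHc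
    have hall : ∀ g : S → ℝ, Integrable fun φ : S → ℝ => (∏ i ∈ T, φ ⬝ᵥ v i) * H φ *
        (Real.exp (φ ⬝ᵥ g) * Real.exp (-(1/2 : ℝ) * (φ ⬝ᵥ A *ᵥ φ))) := fun g =>
      integrable_fieldProd_bdd_tilt hA T v g hHc.aestronglyMeasurable h0
    exact (integrable_dotProduct_mul_of_forall A hc hall w f).congr (Eventually.of_forall fun φ => by
      dsimp only; rw [e])
  have hs' : ∀ i ∈ T, Integrable fun φ : S → ℝ =>
      ((A⁻¹ *ᵥ w) ⬝ᵥ v i) * ((∏ j ∈ T.erase i, φ ⬝ᵥ v j) * H φ * (weight A φ * source f φ)) :=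
    fun i _ => (iPH (T.erase i)).const_mul _
  have hs : Integrable fun φ : S → ℝ =>
      ∑ i ∈ T, ((A⁻¹ *ᵥ w) ⬝ᵥ v i) * ((∏ j ∈ T.erase i, φ ⬝ᵥ v j) * H φ * (weight A φ * source f φ)) :=
    integrable_finsetSum T hs'
  -- pointwise expansion of `∂_{C_s w}(P·H)·weight`
  have hexp : ∀ φ : S → ℝ,
      fderiv ℝ (fun ψ : S → ℝ => (∏ i ∈ T, ψ ⬝ᵥ v i) * H ψ) φ (A⁻¹ *ᵥ w) * (weight A φ * source f φ)
        = (∏ i ∈ T, φ ⬝ᵥ v i) * fderiv ℝ H φ (A⁻¹ *ᵥ w) * (weight A φ * source f φ)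
          + ∑ i ∈ T, ((A⁻¹ *ᵥ w) ⬝ᵥ v i) *
              ((∏ j ∈ T.erase i, φ ⬝ᵥ v j) * H φ * (weight A φ * source f φ)) := fun φ => by
    rw [hG' φ, add_mul, Finset.mul_sum, Finset.sum_mul]
    congr 1
    exact Finset.sum_congr rfl fun i _ => by ring
  have i2 : Integrable fun φ : S → ℝ =>
      fderiv ℝ (fun ψ : S → ℝ => (∏ i ∈ T, ψ ⬝ᵥ v i) * H ψ) φ (A⁻¹ *ᵥ w) * (weight A φ * source f φ) :=
    (iPH'.add hs).congr (Eventually.of_forall fun φ => by simp only [Pi.add_apply, hexp φ])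
  -- the replacement rule for `G = P·H`, then expand the derivative
  have key := ibp_source_of_integrable A hA f hGd w i1 i2 (iPH T)
  have hD : ∫ φ : S → ℝ, fderiv ℝ (fun ψ : S → ℝ => (∏ i ∈ T, ψ ⬝ᵥ v i) * H ψ) φ (A⁻¹ *ᵥ w) *
        (weight A φ * source f φ)
      = (∫ φ : S → ℝ, (∏ i ∈ T, φ ⬝ᵥ v i) * fderiv ℝ H φ (A⁻¹ *ᵥ w) * (weight A φ * source f φ))
        + ∑ i ∈ T, ((A⁻¹ *ᵥ w) ⬝ᵥ v i) *
            ∫ φ : S → ℝ, (∏ j ∈ T.erase i, φ ⬝ᵥ v j) * H φ * (weight A φ * source f φ) := by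
    calc ∫ φ : S → ℝ, fderiv ℝ (fun ψ : S → ℝ => (∏ i ∈ T, ψ ⬝ᵥ v i) * H ψ) φ (A⁻¹ *ᵥ w) *
          (weight A φ * source f φ)
        = ∫ φ : S → ℝ, ((∏ i ∈ T, φ ⬝ᵥ v i) * fderiv ℝ H φ (A⁻¹ *ᵥ w) * (weight A φ * source f φ)
            + ∑ i ∈ T, ((A⁻¹ *ᵥ w) ⬝ᵥ v i) *
                ((∏ j ∈ T.erase i, φ ⬝ᵥ v j) * H φ * (weight A φ * source f φ))) := by
          congr 1
          funext φ
          exact hexp φ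
      _ = (∫ φ : S → ℝ, (∏ i ∈ T, φ ⬝ᵥ v i) * fderiv ℝ H φ (A⁻¹ *ᵥ w) * (weight A φ * source f φ))
            + ∫ φ : S → ℝ, ∑ i ∈ T, ((A⁻¹ *ᵥ w) ⬝ᵥ v i) *
                ((∏ j ∈ T.erase i, φ ⬝ᵥ v j) * H φ * (weight A φ * source f φ)) := integral_add iPH' hs
      _ = _ := by
          rw [integral_finsetSum T hs']
          congr 1
          exact Finset.sum_congr rfl fun i _ => integral_const_mul _ _
  rw [key, hD]
  ring

/-! ## §3  The printed instance: precision `Δ_s = interpForm blk Δ s` -/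

/-- **The replacement rule for the interpolated measure `⟨·⟩_{s_Γ}`** (precision the Dirichlet-interpolated form
`Δ_s = interpForm blk Δ s` of p. 305, fed with `Δ := −Δ_print` positive definite and `s ∈ [0,1]^I`, so that `Δ_s`
is positive definite by `BIJ88DirichletForms305.interpForm_posDef` and `C_s = (Δ_s)⁻¹`):
`∫ Φ(x) G dμ = Σ_y C_s(x,y) ∫ ∂G/∂Φ(y) dμ + (C_sℱ)(x) ∫ G dμ`, `dμ = e^{−½⟨Φ,Δ_sΦ⟩}e^{⟨ℱ,Φ⟩}dΦ`, `G ∈ C¹_b`.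
[cite: BalabanImbrieJaffe1988, §5.13 p.305] -/
theorem ibp_coord_interp {α I : Type} [Fintype α] [DecidableEq α] [DecidableEq I] [Fintype I] (blk : α → I)
    {Δ : Matrix α α ℝ} (hΔ : Δ.PosDef) {s : I → ℝ} (hs : ∀ i, 0 ≤ s i ∧ s i ≤ 1) (f : α → ℝ)
    {G : (α → ℝ) → ℝ} (hG : ContDiff ℝ 1 G) {K₀ K₁ : ℝ} (h0 : ∀ φ, ‖G φ‖ ≤ K₀) (h1 : ∀ φ, ‖fderiv ℝ G φ‖ ≤ K₁)
    (x : α) :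
    ∫ φ : α → ℝ, φ x * G φ * (weight (interpForm blk Δ s) φ * source f φ)
      = (∑ y, (interpForm blk Δ s)⁻¹ x y *
            ∫ φ : α → ℝ, fderiv ℝ G φ (Pi.single y 1) * (weight (interpForm blk Δ s) φ * source f φ))
        + ((interpForm blk Δ s)⁻¹ *ᵥ f) x * ∫ φ : α → ℝ, G φ * (weight (interpForm blk Δ s) φ * source f φ) :=
  ibp_coord _ (interpForm_posDef blk hΔ hs) f hG h0 h1 x

end Literature.MathematicalPhysics.QuantumFieldTheory.BalabanImbrieJaffe1984to88.BIJ88IntegrationByParts305
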